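import Summits.AtomisticToContinuum.HydrodynamicLimit.Theorems.AntiMazurCoboundariesKineticWindowGronwallWindowEnergyMoment
import Literature.MathematicalPhysics.KineticTheory.HardSphereEulerProofs
import Literature.Analysis.FluidPDE.CollisionalTransferMeasurable
import HarnessLib

/-!
# Rényi quasi-invariance from increment tightness — preliminaries
# (helper stub `stub_incrementTightnessPrelim`, line `board-node-dock`, crux `KineticWindowGronwall`, stmt-AtomisticToContinuum-9282)

Crux `Summit.AtomisticToContinuum.HydrodynamicLimit.Theses.AntiMazurCoboundaries.KineticWindowGronwall`, line `board-node-dock`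
(lead c6). Preliminaries for the registered toolkit stub `stub_windowRenyiOfIncrementTightness` (file
`…KineticWindowGronwallWindowRenyiOfIncrementTightness.lean`): the order-`p` Rényi integral
`∫ (ψ_N(Φ_{-s} z)/ψ_N(z))^p dλ_N` of the local Gibbs law `λ_N = ψ_N · L` (`L` Liouville) of GENERAL continuous data
`(a, θ₀, u₀)`, `a, θ₀ > 0`.

CONTENT (registered as `IncrementTightnessPrelim`, two clauses).
(1) FORWARD FORM. The one-body profile is `a(x) M_{1,u₀(x),θ₀(x)}(v) = exp(ℓ(x) − θ₀(x)⁻¹‖v‖²/2 + ⟪θ₀(x)⁻¹u₀(x), v⟫)` with the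
POSITION-ONLY continuous `ℓ = log(a (2πθ₀)^{-3/2}) − ‖u₀‖²/(2θ₀)` (`ell`), so on the hard-sphere domain `ψ_N = Z⁻¹ exp S` with
`S(z) = Σᵢ ℓ(xᵢ) − energyObservable θ₀⁻¹ z + momentumObservable (θ₀⁻¹•u₀) z` (`logW`). For `Z > 0`, Liouville invariance
(`HardSphereFlow.measurePreserving`; `flow_neg_flow` on the conull good set) gives
`∫ (ψ_N(Φ_{-s}z)/ψ_N z)^p dλ_N = ∫ exp((p−1)(S(w) − S(Φ_s w))) λ_N(dw)`.
(2) STATICS. With `θ₀ ≤ θM`, `‖u₀‖ ≤ U` and `0 ≤ c ≤ 1/(4θM)`: `∫ exp(c E) dλ_N ≤ exp((1 + 2U² + 12θM)(c/2)(N+1))` at ANY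
reduced density — disintegration into positions and independent Gaussian velocities (`lintegral_localGibbsMeasure`, total mass
`Z⁻¹Z ≤ 1`) and the one-site bound `KineticWindowGronwallWindowEnergyMoment.lintegral_exp_mul_one_add_sq_norm_gaussMeasure_le`.
Folklore (local equilibrium states, Spohn 1991 Part I §2.3; Liouville theorem for hard spheres, GST 2013 Prop. 4.1.1).
No Theses declaration is concluded; no named fact is used.
-/

noncomputable section

namespace Summit.AtomisticToContinuum.HydrodynamicLimit.Theorems.KineticWindowGronwallWindowRenyiOfIncrementTightnessPrelim

open _root_.MeasureTheory _root_.Set _root_.Filter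
open scoped _root_.ENNReal
open Literature.Analysis.FluidPDE Literature.MathematicalPhysics.KineticTheory

/-! ## §1 Objects -/

/-- The hard-sphere flow of `N+1` spheres at reduced density `σ` on `𝕋³`. -/
abbrev TFlow (σ : ℝ) (N : ℕ) : Type :=
  HardSphereFlow (Torus.geometry (Fin 3)) (hsDiameter σ N) (N + 1)

/-- The Liouville measure of `N+1` spheres at reduced density `σ` on `𝕋³`. -/
abbrev liou (σ : ℝ) (N : ℕ) : Measure (Config (N + 1) (Fin 3) T3) :=
  liouville (Torus.geometry (Fin 3)) (N + 1) (hsDiameter σ N)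

/-- The local Gibbs DENSITY with respect to the Liouville measure (the canonical density of the local Gibbs profile,
as an extended nonnegative real): `localGibbsLaw σ a u₀ θ₀ N Φ = (liou σ N).withDensity (lgDensity σ a θ₀ u₀ N)`. -/
def lgDensity (σ : ℝ) (a θ₀ : T3 → ℝ) (u₀ : T3 → V3) (N : ℕ) (z : Config (N + 1) (Fin 3) T3) : ℝ≥0∞ :=
  ENNReal.ofReal (canonicalDensity (Torus.geometry (Fin 3)) (hsDiameter σ N) (N + 1) (localGibbsProfile a u₀ θ₀) z)

/-! ## §2 The log-density: position part `ℓ`, weighted energy, tested momentum -/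

section LogDensity

variable {a θ₀ : T3 → ℝ} {u₀ : T3 → V3}

/-- The POSITION-ONLY part of the one-body log-density of the local Gibbs profile:
`ℓ(x) = log(a(x) · (2πθ₀(x))^{-3/2}) − ‖u₀(x)‖²/(2θ₀(x))`. -/
def ell (a θ₀ : T3 → ℝ) (u₀ : T3 → V3) (x : T3) : ℝ :=
  Real.log (a x * (1 * (2 * Real.pi * θ₀ x) ^ (-(Module.finrank ℝ V3 : ℝ) / 2))) - ‖u₀ x‖ ^ 2 / (2 * θ₀ x)

/-- `ℓ` is continuous for continuous data with `a, θ₀ > 0`. [folklore] -/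
theorem continuous_ell (ha : Continuous a) (hθ : Continuous θ₀) (hu : Continuous u₀) (ha0 : ∀ x, 0 < a x)
    (hθ0 : ∀ x, 0 < θ₀ x) : Continuous (ell a θ₀ u₀) := by
  have h2 : ∀ x, (2 * Real.pi * θ₀ x) ≠ 0 := fun x => (mul_pos (mul_pos two_pos Real.pi_pos) (hθ0 x)).ne'
  unfold ell
  refine Continuous.sub (Continuous.log ?_ fun x => ?_) ((hu.norm.pow 2).div (continuous_const.mul hθ) fun x => ?_)
  · exact ha.mul (continuous_const.mul ((continuous_const.mul hθ).rpow_const fun x => Or.inl (h2 x)))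
  · exact (mul_pos (ha0 x) (mul_pos one_pos (Real.rpow_pos_of_pos
      (mul_pos (mul_pos two_pos Real.pi_pos) (hθ0 x)) _))).ne'
  · exact (mul_pos two_pos (hθ0 x)).ne'

/-- The local Gibbs profile is `exp(ℓ(x) − θ₀(x)⁻¹‖v‖²/2 + ⟪θ₀(x)⁻¹u₀(x), v⟫)` (`a, θ₀ > 0` at `x`; expand
`‖v − u‖² = ‖v‖² − 2⟪u, v⟫ + ‖u‖²`). [folklore] -/
theorem localGibbsProfile_eq_exp {y : T3 × V3} (ha0 : 0 < a y.1) (hθ0 : 0 < θ₀ y.1) :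
    localGibbsProfile a u₀ θ₀ y =
      Real.exp (ell a θ₀ u₀ y.1 - (θ₀ y.1)⁻¹ * (‖y.2‖ ^ 2 / 2) + inner ℝ ((θ₀ y.1)⁻¹ • u₀ y.1) y.2) := by
  have hc : 0 < a y.1 * (1 * (2 * Real.pi * θ₀ y.1) ^ (-(Module.finrank ℝ V3 : ℝ) / 2)) :=
    mul_pos ha0 (mul_pos one_pos (Real.rpow_pos_of_pos (mul_pos (mul_pos two_pos Real.pi_pos) hθ0) _))
  have h1 : inner ℝ ((θ₀ y.1)⁻¹ • u₀ y.1) y.2 = (θ₀ y.1)⁻¹ * inner ℝ (u₀ y.1) y.2 := real_inner_smul_left _ _ _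
  have h2 : ‖y.2 - u₀ y.1‖ ^ 2 = ‖y.2‖ ^ 2 - 2 * inner ℝ (u₀ y.1) y.2 + ‖u₀ y.1‖ ^ 2 := by
    rw [norm_sub_sq_real, real_inner_comm]
  have hexp : ell a θ₀ u₀ y.1 - (θ₀ y.1)⁻¹ * (‖y.2‖ ^ 2 / 2) + inner ℝ ((θ₀ y.1)⁻¹ • u₀ y.1) y.2 =
      Real.log (a y.1 * (1 * (2 * Real.pi * θ₀ y.1) ^ (-(Module.finrank ℝ V3 : ℝ) / 2))) +
        -‖y.2 - u₀ y.1‖ ^ 2 / (2 * θ₀ y.1) := by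
    rw [ell, h1, h2]
    field_simp
    ring
  rw [hexp, Real.exp_add, Real.exp_log hc, localGibbsProfile, localMaxwellian]
  ring

/-- The `n`-body log-density `S(z) = Σᵢ ℓ(xᵢ) − Σᵢ θ₀(xᵢ)⁻¹‖vᵢ‖²/2 + Σᵢ ⟪θ₀(xᵢ)⁻¹u₀(xᵢ), vᵢ⟫`, written with the
energy and momentum observables of `CollisionalTransfer`. -/
def logW (a θ₀ : T3 → ℝ) (u₀ : T3 → V3) {n : ℕ} (z : Config n (Fin 3) T3) : ℝ :=
  ∑ i, ell a θ₀ u₀ (z i).1 - energyObservable (fun x => (θ₀ x)⁻¹) z +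
    momentumObservable (fun x => (θ₀ x)⁻¹ • u₀ x) z

/-- `S` is continuous for continuous data with `a, θ₀ > 0`. [folklore] -/
theorem continuous_logW (ha : Continuous a) (hθ : Continuous θ₀) (hu : Continuous u₀) (ha0 : ∀ x, 0 < a x)
    (hθ0 : ∀ x, 0 < θ₀ x) {n : ℕ} : Continuous (logW a θ₀ u₀ : Config n (Fin 3) T3 → ℝ) := by
  have hθi : Continuous fun x => (θ₀ x)⁻¹ := hθ.inv₀ fun x => (hθ0 x).ne'
  unfold logW
  refine ((continuous_finsetSum _ fun i _ => (continuous_ell ha hθ hu ha0 hθ0).comp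
    (continuous_apply i).fst).sub (continuous_energyObservable hθi)).add
    (continuous_momentumObservable (hθi.smul hu))

/-- The tensor power of the local Gibbs profile is `exp(S)` (`a, θ₀ > 0`). [folklore] -/
theorem tensorPow_eq_exp (ha0 : ∀ x, 0 < a x) (hθ0 : ∀ x, 0 < θ₀ x) {n : ℕ} (z : Config n (Fin 3) T3) :
    tensorPow n (localGibbsProfile a u₀ θ₀) z = Real.exp (logW a θ₀ u₀ z) := by
  have h : logW a θ₀ u₀ z = ∑ i, (ell a θ₀ u₀ (z i).1 - (θ₀ (z i).1)⁻¹ * (‖(z i).2‖ ^ 2 / 2) +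
      inner ℝ ((θ₀ (z i).1)⁻¹ • u₀ (z i).1) (z i).2) := by
    simp only [logW, energyObservable, momentumObservable, Finset.sum_add_distrib, Finset.sum_sub_distrib]
  rw [h, Real.exp_sum, tensorPow]
  exact Finset.prod_congr rfl fun i _ => localGibbsProfile_eq_exp (ha0 _) (hθ0 _)

/-- On the hard-sphere domain the canonical density of the local Gibbs profile is `Z⁻¹ exp(S)`. [folklore] -/
theorem canonicalDensity_eq_of_mem (ha0 : ∀ x, 0 < a x) (hθ0 : ∀ x, 0 < θ₀ x) {σ : ℝ} {N : ℕ}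
    {z : Config (N + 1) (Fin 3) T3} (hz : z ∈ hardSphereDomain (Torus.geometry (Fin 3)) (N + 1) (hsDiameter σ N)) :
    canonicalDensity (Torus.geometry (Fin 3)) (hsDiameter σ N) (N + 1) (localGibbsProfile a u₀ θ₀) z =
      (canonicalPartition (Torus.geometry (Fin 3)) (hsDiameter σ N) (N + 1) (localGibbsProfile a u₀ θ₀))⁻¹ *
        Real.exp (logW a θ₀ u₀ z) := by
  rw [canonicalDensity, Set.indicator_of_mem hz, tensorPow_eq_exp ha0 hθ0]

end LogDensity

/-! ## §3 Liouville invariance: the forward form of the Rényi integral -/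

section Forward

variable {σ : ℝ} {N : ℕ} (Φ : TFlow σ N) {a θ₀ : T3 → ℝ} {u₀ : T3 → V3}

/-- **Pointwise transport identity on good orbits** (`Z > 0`): for good `w` and real `s`, `p`,
`ψ(Φ_s w) · (ψ(Φ_{-s}(Φ_s w))/ψ(Φ_s w))^p = ψ(w) · exp((p−1)(S(w) − S(Φ_s w)))`. [folklore] -/
theorem density_transport_eq (ha0 : ∀ x, 0 < a x) (hθ0 : ∀ x, 0 < θ₀ x)
    (hZ : 0 < canonicalPartition (Torus.geometry (Fin 3)) (hsDiameter σ N) (N + 1) (localGibbsProfile a u₀ θ₀))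
    {w : Config (N + 1) (Fin 3) T3} (hw : w ∈ Φ.good) (s p : ℝ) :
    lgDensity σ a θ₀ u₀ N (Φ.flow s w) *
        (lgDensity σ a θ₀ u₀ N (Φ.flow (-s) (Φ.flow s w)) / lgDensity σ a θ₀ u₀ N (Φ.flow s w)) ^ p =
      lgDensity σ a θ₀ u₀ N w *
        ENNReal.ofReal (Real.exp ((p - 1) * (logW a θ₀ u₀ w - logW a θ₀ u₀ (Φ.flow s w)))) := by
  rw [Φ.flow_neg_flow s hw]
  simp only [lgDensity]
  rw [canonicalDensity_eq_of_mem ha0 hθ0 (Φ.good_subset hw),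
    canonicalDensity_eq_of_mem ha0 hθ0 (Φ.good_subset (Φ.mapsTo_good s hw))]
  set Z := canonicalPartition (Torus.geometry (Fin 3)) (hsDiameter σ N) (N + 1) (localGibbsProfile a u₀ θ₀)
  set S₀ := logW a θ₀ u₀ w
  set S₁ := logW a θ₀ u₀ (Φ.flow s w)
  have hZi : 0 < Z⁻¹ := inv_pos.2 hZ
  have hA : 0 < Z⁻¹ * Real.exp S₁ := mul_pos hZi (Real.exp_pos _)
  have hB : 0 ≤ Z⁻¹ * Real.exp S₀ := (mul_pos hZi (Real.exp_pos _)).le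
  rw [← ENNReal.ofReal_div_of_pos hA, mul_div_mul_left _ _ hZi.ne', ← Real.exp_sub,
    ENNReal.ofReal_rpow_of_pos (Real.exp_pos _), ← Real.exp_mul, ← ENNReal.ofReal_mul hA.le,
    ← ENNReal.ofReal_mul hB]
  have key : Real.exp S₁ * Real.exp ((S₀ - S₁) * p) = Real.exp S₀ * Real.exp ((p - 1) * (S₀ - S₁)) := by
    rw [← Real.exp_add, ← Real.exp_add]
    congr 1
    ring
  rw [mul_assoc, key, ← mul_assoc]

/-- **Forward form of the Rényi integral** (`Z > 0`): for real `s`, `p`,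
`∫ (ψ(Φ_{-s}z)/ψ(z))^p λ_N(dz) = ∫ exp((p−1)(S(w) − S(Φ_s w))) λ_N(dw)` — pull out the density, substitute `z = Φ_s w`
under the invariant Liouville measure, use the transport identity on the conull good set, reinsert the density. [folklore] -/
theorem lintegral_renyi_eq_forward (ha : Continuous a) (hθ : Continuous θ₀) (hu : Continuous u₀)
    (ha0 : ∀ x, 0 < a x) (hθ0 : ∀ x, 0 < θ₀ x)
    (hZ : 0 < canonicalPartition (Torus.geometry (Fin 3)) (hsDiameter σ N) (N + 1) (localGibbsProfile a u₀ θ₀))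
    (s p : ℝ) :
    ∫⁻ z, (lgDensity σ a θ₀ u₀ N (Φ.flow (-s) z) / lgDensity σ a θ₀ u₀ N z) ^ p ∂(localGibbsLaw σ a u₀ θ₀ N Φ) =
      ∫⁻ w, ENNReal.ofReal (Real.exp ((p - 1) * (logW a θ₀ u₀ w - logW a θ₀ u₀ (Φ.flow s w))))
        ∂(localGibbsLaw σ a u₀ θ₀ N Φ) := by
  set ψ := lgDensity σ a θ₀ u₀ N with hψdef
  have hlaw : localGibbsLaw σ a u₀ θ₀ N Φ = (liou σ N).withDensity ψ := rfl
  have hψm : Measurable ψ :=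
    ENNReal.measurable_ofReal.comp (measurable_canonicalDensity _ _ (measurable_localGibbsProfile ha hθ hu))
  have hF : Measurable fun z => (ψ (Φ.flow (-s) z) / ψ z) ^ p :=
    ((hψm.comp (Φ.measurable_flow (-s))).div hψm).pow_const p
  have hG : Measurable fun z => ψ z * (ψ (Φ.flow (-s) z) / ψ z) ^ p := hψm.mul hF
  have hSm : Measurable (logW a θ₀ u₀ : Config (N + 1) (Fin 3) T3 → ℝ) :=
    (continuous_logW ha hθ hu ha0 hθ0).measurable
  have hH : Measurable fun w =>
      ENNReal.ofReal (Real.exp ((p - 1) * (logW a θ₀ u₀ w - logW a θ₀ u₀ (Φ.flow s w)))) :=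
    (measurable_const.mul (hSm.sub (hSm.comp (Φ.measurable_flow s)))).exp.ennreal_ofReal
  rw [hlaw, lintegral_withDensity_eq_lintegral_mul _ hψm hF, lintegral_withDensity_eq_lintegral_mul _ hψm hH]
  calc ∫⁻ z, (ψ * fun z => (ψ (Φ.flow (-s) z) / ψ z) ^ p) z ∂(liou σ N)
      = ∫⁻ w, (fun z => ψ z * (ψ (Φ.flow (-s) z) / ψ z) ^ p) (Φ.flow s w) ∂(liou σ N) :=
        ((Φ.measurePreserving s).lintegral_comp hG).symm
    _ = ∫⁻ w, (ψ * fun w =>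
          ENNReal.ofReal (Real.exp ((p - 1) * (logW a θ₀ u₀ w - logW a θ₀ u₀ (Φ.flow s w))))) w ∂(liou σ N) := by
        refine lintegral_congr_ae ?_
        filter_upwards [Φ.ae_mem_good] with w hw
        exact density_transport_eq Φ ha0 hθ0 hZ hw s p

end Forward

/-! ## §4 Statics: Gaussian fibres with `x`-dependent temperature and drift (any reduced density) -/

section Statics

variable {a θ₀ : T3 → ℝ} {u₀ : T3 → V3}

/-- **Fibrewise bound** (general continuous data, any reduced density): if a measurable one-body velocity factor
`g ≥ 0` has `∫ g dN(u₀(x), θ₀(x) id) ≤ K` at every `x`, then `∫ ∏ᵢ g(vᵢ) dλ_N ≤ K^{N+1}` (disintegration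
`lintegral_localGibbsMeasure` into positions and independent Gaussian velocities; total mass `Z⁻¹Z ≤ 1`). [folklore] -/
theorem lintegral_prod_vel_le_pow (ha : Continuous a) (hθ : Continuous θ₀) (hu : Continuous u₀)
    (ha0 : ∀ x, 0 < a x) (hθ0 : ∀ x, 0 < θ₀ x) (σ : ℝ) (N : ℕ) (Φ : TFlow σ N) {g : V3 → ℝ≥0∞}
    (hg : Measurable g) {K : ℝ≥0∞} (hK : ∀ x : T3, ∫⁻ v, g v ∂gaussMeasure (u₀ x) (θ₀ x) ≤ K) (hKtop : K ≠ ∞) :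
    ∫⁻ z, ∏ i, g (z i).2 ∂(localGibbsLaw σ a u₀ θ₀ N Φ) ≤ K ^ (N + 1) := by
  have ha0' : ∀ x, 0 ≤ a x := fun x => (ha0 x).le
  have hGm : Measurable fun z : Config (N + 1) (Fin 3) T3 => ∏ i, g (z i).2 :=
    Finset.measurable_prod _ fun i _ => hg.comp ((measurable_pi_apply i).snd)
  -- total mass `≤ 1`
  have hmass : localGibbsMeasure σ a u₀ θ₀ N univ ≤ 1 := by
    rw [localGibbsMeasure_univ ha hθ hu ha0' hθ0 σ N]
    set Zp := posPartition a (hsDiameter σ N) (N + 1)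
    have hZp : 0 ≤ Zp := posPartition_nonneg ha0' _ _
    rw [← ENNReal.ofReal_mul (inv_nonneg.2 hZp), ← ENNReal.ofReal_one]
    refine ENNReal.ofReal_le_ofReal ?_
    rcases hZp.eq_or_lt with h | h
    · rw [← h]; simp
    · rw [inv_mul_cancel₀ h.ne']
  -- velocity fibres
  have hvel : ∀ x : Fin (N + 1) → T3,
      ∫⁻ v, (∏ i, g ((zipConfig (x, v) i).2)) ∂velMeasure u₀ θ₀ x ≤ K ^ (N + 1) := by
    intro x
    have h1 : ∫⁻ v, (∏ i, g ((zipConfig (x, v) i).2)) ∂velMeasure u₀ θ₀ x =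
        ∏ i : Fin (N + 1), ∫⁻ w, g w ∂gaussMeasure (u₀ (x i)) (θ₀ (x i)) := by
      simp only [zipConfig_apply, velMeasure]
      exact lintegral_fintype_prod_eq_prod' (fun i => gaussMeasure (u₀ (x i)) (θ₀ (x i))) (f := fun _ w => g w)
        fun _ => hg
    rw [h1]
    calc ∏ i : Fin (N + 1), ∫⁻ w, g w ∂gaussMeasure (u₀ (x i)) (θ₀ (x i)) ≤ ∏ _i : Fin (N + 1), K :=
          Finset.prod_le_prod' fun i _ => hK (x i)
      _ = K ^ (N + 1) := by rw [Finset.prod_const, Finset.card_univ, Fintype.card_fin]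
  have hunit := lintegral_localGibbsMeasure ha hθ hu ha0' hθ0 σ N (G := fun _ => (1 : ℝ≥0∞)) measurable_const
  simp only [lintegral_const, measure_univ, mul_one, one_mul] at hunit
  set W : (Fin (N + 1) → T3) → ℝ≥0∞ := fun x => ENNReal.ofReal ((canonicalPartition (Torus.geometry (Fin 3))
    (hsDiameter σ N) (N + 1) (localGibbsProfile a u₀ θ₀))⁻¹ * posWeight a (hsDiameter σ N) (N + 1) x)
  rw [localGibbsLaw_eq, lintegral_localGibbsMeasure ha hθ hu ha0' hθ0 σ N hGm]
  calc ∫⁻ x, W x * ∫⁻ v, (∏ i, g ((zipConfig (x, v) i).2)) ∂velMeasure u₀ θ₀ x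
      ≤ ∫⁻ x, W x * K ^ (N + 1) := lintegral_mono fun x => mul_le_mul' le_rfl (hvel x)
    _ = (∫⁻ x, W x) * K ^ (N + 1) := lintegral_mul_const' _ _ (ENNReal.pow_ne_top hKtop)
    _ ≤ 1 * K ^ (N + 1) := mul_le_mul' (by rw [← hunit]; exact hmass) le_rfl
    _ = K ^ (N + 1) := one_mul _

/-- **Exponential moment of the kinetic energy** (general continuous data with `0 < θ₀ ≤ θM`, `‖u₀‖ ≤ U`, any reduced
density): for `0 ≤ c ≤ 1/(4θM)`, `∫ exp(c·E(z)) dλ_N ≤ exp((1 + 2U² + 12θM)(c/2)(N+1))` — `exp(cE) ≤ ∏ᵢ exp((c/2)(1 + ‖vᵢ‖²))`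
and the one-site bound `KineticWindowGronwallWindowEnergyMoment.lintegral_exp_mul_one_add_sq_norm_gaussMeasure_le`. [folklore] -/
theorem lintegral_exp_mul_configEnergy_le (ha : Continuous a) (hθ : Continuous θ₀) (hu : Continuous u₀)
    (ha0 : ∀ x, 0 < a x) (hθ0 : ∀ x, 0 < θ₀ x) {θM U : ℝ} (hθM : ∀ x, θ₀ x ≤ θM) (hU : ∀ x, ‖u₀ x‖ ≤ U)
    (σ : ℝ) (N : ℕ) (Φ : TFlow σ N) {c : ℝ} (hc0 : 0 ≤ c) (hc : c ≤ 1 / (4 * θM)) :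
    ∫⁻ z, ENNReal.ofReal (Real.exp (c * configEnergy z)) ∂(localGibbsLaw σ a u₀ θ₀ N Φ) ≤
      ENNReal.ofReal (Real.exp ((1 + 2 * U ^ 2 + 12 * θM) * (c / 2) * ((N : ℝ) + 1))) := by
  have hθMpos : 0 < θM := (hθ0 0).trans_le (hθM 0)
  set g : V3 → ℝ≥0∞ := fun v => ENNReal.ofReal (Real.exp (c / 2 * (1 + ‖v‖ ^ 2))) with hgdef
  have hgm : Measurable g := (Real.continuous_exp.comp (by fun_prop)).measurable.ennreal_ofReal
  set K : ℝ≥0∞ := ENNReal.ofReal (Real.exp ((1 + 2 * U ^ 2 + 12 * θM) * (c / 2))) with hKdef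
  have hK : ∀ x : T3, ∫⁻ v, g v ∂gaussMeasure (u₀ x) (θ₀ x) ≤ K := fun x =>
    KineticWindowGronwallWindowEnergyMoment.lintegral_exp_mul_one_add_sq_norm_gaussMeasure_le (hθ0 x) (hθM x) (hU x)
      (by positivity) (by
        rw [div_le_div_iff₀ two_pos (by positivity)]
        have h4 : c * (4 * θM) ≤ 1 := (le_div_iff₀ (by positivity)).mp hc
        linarith)
  -- pointwise: `exp(c E) ≤ ∏ᵢ g(vᵢ)`
  have hpt : ∀ z : Config (N + 1) (Fin 3) T3, ENNReal.ofReal (Real.exp (c * configEnergy z)) ≤ ∏ i, g (z i).2 := by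
    intro z
    simp only [hgdef]
    rw [← ENNReal.ofReal_prod_of_nonneg fun i _ => (Real.exp_pos _).le, ← Real.exp_sum]
    refine ENNReal.ofReal_le_ofReal (Real.exp_le_exp.2 ?_)
    have h1 : c * configEnergy z = ∑ i, c / 2 * ‖(z i).2‖ ^ 2 := by
      simp only [configEnergy, Finset.mul_sum]
      exact Finset.sum_congr rfl fun i _ => by ring
    rw [h1]
    exact Finset.sum_le_sum fun i _ => by nlinarith [sq_nonneg ‖(z i).2‖]
  calc ∫⁻ z, ENNReal.ofReal (Real.exp (c * configEnergy z)) ∂(localGibbsLaw σ a u₀ θ₀ N Φ)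
      ≤ ∫⁻ z, ∏ i, g (z i).2 ∂(localGibbsLaw σ a u₀ θ₀ N Φ) := lintegral_mono hpt
    _ ≤ K ^ (N + 1) := lintegral_prod_vel_le_pow ha hθ hu ha0 hθ0 σ N Φ hgm hK ENNReal.ofReal_ne_top
    _ = ENNReal.ofReal (Real.exp ((1 + 2 * U ^ 2 + 12 * θM) * (c / 2) * ((N : ℝ) + 1))) := by
        rw [hKdef, ← ENNReal.ofReal_pow (Real.exp_pos _).le, ← Real.exp_nat_mul]
        push_cast
        ring_nf

end Statics


/-! ## §5 The registered helper statement -/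

/-- **Helper statement `IncrementTightnessPrelim`** (two clauses, general continuous data `a, θ₀ > 0`, any reduced density):
(1) for `Z > 0` the order-`p` Rényi integral of the local Gibbs law along the flow is the forward expectation
`∫ exp((p−1)(S(w) − S(Φ_s w))) λ_N(dw)` of the log-density increment; (2) the exponential moment of the kinetic energy
`∫ exp(c E) dλ_N ≤ exp((1 + 2U² + 12θM)(c/2)(N+1))` for `0 ≤ c ≤ 1/(4θM)`, `θ₀ ≤ θM`, `‖u₀‖ ≤ U`. -/
def IncrementTightnessPrelim : Prop :=
  (∀ (σ : ℝ) (a θ₀ : T3 → ℝ) (u₀ : T3 → V3), Continuous a → Continuous θ₀ → Continuous u₀ →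
    (∀ x, 0 < a x) → (∀ x, 0 < θ₀ x) → ∀ (N : ℕ) (Φ : TFlow σ N) (s p : ℝ),
    0 < canonicalPartition (Torus.geometry (Fin 3)) (hsDiameter σ N) (N + 1) (localGibbsProfile a u₀ θ₀) →
    ∫⁻ z, (lgDensity σ a θ₀ u₀ N (Φ.flow (-s) z) / lgDensity σ a θ₀ u₀ N z) ^ p ∂(localGibbsLaw σ a u₀ θ₀ N Φ) =
      ∫⁻ w, ENNReal.ofReal (Real.exp ((p - 1) * (logW a θ₀ u₀ w - logW a θ₀ u₀ (Φ.flow s w))))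
        ∂(localGibbsLaw σ a u₀ θ₀ N Φ)) ∧
  (∀ (σ : ℝ) (a θ₀ : T3 → ℝ) (u₀ : T3 → V3), Continuous a → Continuous θ₀ → Continuous u₀ →
    (∀ x, 0 < a x) → (∀ x, 0 < θ₀ x) → ∀ (θM U : ℝ), (∀ x, θ₀ x ≤ θM) → (∀ x, ‖u₀ x‖ ≤ U) →
    ∀ (N : ℕ) (Φ : TFlow σ N) (c : ℝ), 0 ≤ c → c ≤ 1 / (4 * θM) →
      ∫⁻ z, ENNReal.ofReal (Real.exp (c * configEnergy z)) ∂(localGibbsLaw σ a u₀ θ₀ N Φ) ≤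
        ENNReal.ofReal (Real.exp ((1 + 2 * U ^ 2 + 12 * θM) * (c / 2) * ((N : ℝ) + 1))))

/-- **`stub_incrementTightnessPrelim`: the registered helper statement `IncrementTightnessPrelim` holds**
(`lintegral_renyi_eq_forward` and `lintegral_exp_mul_configEnergy_le`). [folklore] -/
theorem stub_incrementTightnessPrelim : IncrementTightnessPrelim :=
  ⟨fun _σ _a _θ₀ _u₀ ha hθ hu ha0 hθ0 _N Φ s p hZ => lintegral_renyi_eq_forward Φ ha hθ hu ha0 hθ0 hZ s p,
    fun _σ _a _θ₀ _u₀ ha hθ hu ha0 hθ0 _θM _U hθM hU N Φ _c hc0 hc =>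
      lintegral_exp_mul_configEnergy_le ha hθ hu ha0 hθ0 hθM hU _ N Φ hc0 hc⟩

end Summit.AtomisticToContinuum.HydrodynamicLimit.Theorems.KineticWindowGronwallWindowRenyiOfIncrementTightnessPrelim

end
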